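import Mathlib
import Summits.ValiantsHypothesis.ValiantsHypothesis.Theorems.NewtonUnitEquationsTwoProductsPlanarCellSingleRelationPrelim
import HarnessLib

/-!
# Crux `TwoProducts` (stmt-ValiantsHypothesis-5906), planar cells with ONE relation class: the two family bounds
# (a MERGED family `{J-part = a₀|J}` has ≤ 2(m+1) points per cell; a LONE family closed under in-family upgrades has ≤ 2(m+1))

Helper mode (`--supports stmt-ValiantsHypothesis-5906 --as helper`; val-lit-p3 g14, KEEP lineage), toward rung R1
`stub_singleRelation` of `Cruxes/TwoProducts/Lines/relation_ladder.lean` (val-idea-8 g2); route of val-neg-1 g1's memo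
`NOTE-neg1-5906-negative-followups.md` §1 on the p603804 / p604128 template.  Setting: tails in `A_j ∌ 0`, one cell family `S`
with a cell weight `ζ`, representations `rep l ∈ ∏(A_j ∪ {0})` with letters in `tailSupport ∪ {0}`, and the single relation
`(J, a₀, b₀)` (`hSR`).
* `card_merged_le`: the visible points whose representation has `J`-part `a₀|J` number `≤ 2(m+1)` — by
  `exists_coeff_tailDiff_of_Jpart` their coefficients (and those of their off-`J` upgrades) are `cF·F_off − cG·G_off` with
  constants, so `card_le_of_superset_const` runs in the two classes `cF·F_off ≠ 0`, `cG·G_off ≠ 0`.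
* `card_lone_group_le`: a sub-family `G ⊆ S` whose `≤ 2`-position upgrades by letters of members of `G` are all uniquely
  represented has `≤ 2(m+1)` points — `card_clean_class_le` (p604128) in the class `F ≠ 0` and, through the `u ↔ v` symmetry
  (`tailSupport_swap`, `logSupport_swap`, `validWeight_swap`, p604378), in the class `G ≠ 0`.
Honest framing: helper lemmas for a witness rung OUTSIDE the cone of an OPEN crux line; `PlanarCellBound`, the residual, the
crux `TwoProducts` and `VP ≠ VNP` are OPEN and NOT claimed.  No instances, no notation, no named facts. [folklore]
-/

noncomputable section

-- Sub = Summit single-conjunct layout: the duplicated namespace component is mandated by the tree.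
set_option linter.dupNamespace false

open scoped BigOperators
open MvPolynomial
open Summit.ValiantsHypothesis.ValiantsHypothesis.Theorems.NewtonUnitEquations.TwoProducts.FormalLogLinearisation

namespace Summit.ValiantsHypothesis.ValiantsHypothesis.Theorems.NewtonUnitEquations.TwoProducts.PlanarCell

variable {m : ℕ}

/-! ## The merged family -/

/-- **MERGED FAMILY BOUND.**  Under the single relation `(J, a₀, b₀)`, in one cell the visible points whose representation
has `J`-part `a₀|J` number at most `2(m + 1)`. [folklore] -/
theorem card_merged_le (u v : Fin m → MvPolynomial (Fin 2) ℂ) (A : Fin m → Finset Expo)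
    (hA0 : ∀ j, (0 : Expo) ∉ A j) (huA : ∀ j, (u j).support ⊆ A j) (hvA : ∀ j, (v j).support ⊆ A j)
    (J : Finset (Fin m)) (a₀ b₀ : Fin m → Expo)
    (hSR : ∀ a ∈ tuples A, ∀ b ∈ tuples A, a ≠ b → ∑ j, a j = ∑ j, b j →
      (∀ j, a j ≠ b j ↔ j ∈ J) ∧ ((∀ j ∈ J, a j = a₀ j ∧ b j = b₀ j) ∨ (∀ j ∈ J, a j = b₀ j ∧ b j = a₀ j)))
    (R : Expo → Expo → Prop) (S : Finset Expo)
    (hS : ∀ l ∈ S, ∃ ξ : Fin 2 → ℝ, ValidWeight u v ξ ∧ IsStrictTop ξ (logSupport u v) l ∧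
      ∀ e ∈ tailSupport u v, ∀ e' ∈ tailSupport u v, (R e e' ↔ wt ξ e ≤ wt ξ e'))
    (ζ : Fin 2 → ℝ) (hζval : ValidWeight u v ζ)
    (hRζ : ∀ e ∈ tailSupport u v, ∀ e' ∈ tailSupport u v, (R e e' ↔ wt ζ e ≤ wt ζ e'))
    (rep : Expo → Fin m → Expo) (hrepPF : ∀ l ∈ S, rep l ∈ tuples A)
    (hrepsum : ∀ l ∈ S, ∑ j, rep l j = l)
    (hrepT : ∀ l ∈ S, ∀ i, rep l i = 0 ∨ rep l i ∈ tailSupport u v) :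
    (S.filter fun l => ∀ i ∈ J, rep l i = a₀ i).card ≤ 2 * (m + 1) := by
  classical
  obtain ⟨cF, cG, hcoef⟩ := exists_coeff_tailDiff_of_Jpart u v A hA0 huA hvA J a₀ b₀ hSR
  set T := tailSupport u v with hT
  set Sa := S.filter fun l => ∀ i ∈ J, rep l i = a₀ i with hSa
  have hSaS : ∀ l ∈ Sa, l ∈ S := fun l hl => (Finset.mem_filter.1 hl).1
  have hSaJ : ∀ l ∈ Sa, ∀ i ∈ J, rep l i = a₀ i := fun l hl => (Finset.mem_filter.1 hl).2
  -- letter coefficients off the block (`1` on the block)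
  set f : Fin m → Expo → ℂ := fun i e => if i ∈ J then 1 else hatCoeff (u i) e with hf
  set g : Fin m → Expo → ℂ := fun i e => if i ∈ J then 1 else hatCoeff (v i) e with hg
  have hcoef' : ∀ c ∈ tuples A, (∀ i ∈ J, c i = a₀ i) →
      coeff (∑ i, c i) (tailDiff u v) = cF * ∏ i, f i (c i) - cG * ∏ i, g i (c i) := fun c hc hcJ => by
    rw [hcoef c hc hcJ]
  -- general cell facts
  have hu0 : ∀ j, coeff 0 (u j) = 0 := fun j => notMem_support_iff.1 fun h => hA0 j (huA j h)
  have hv0 : ∀ j, coeff 0 (v j) = 0 := fun j => notMem_support_iff.1 fun h => hA0 j (hvA j h)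
  choose! ξ hval htop hRξ using hS
  have htopW : ∀ l ∈ S, IsStrictTop (ξ l) ↑(tailDiff u v).support l := fun l hl =>
    (stub_logLinearisation m u v hu0 hv0 (ξ l) (hval l hl) l).2 (htop l hl)
  have hsupp : ∀ l ∈ S, l ∈ (tailDiff u v).support := fun l hl => (htopW l hl).1
  have hwt0 : ∀ (η : Fin 2 → ℝ), wt η 0 = 0 := fun η => by simp [wt]
  have hval_neg : ∀ l ∈ S, ∀ e ∈ T, wt (ξ l) e < 0 := by
    intro l hl e he
    rcases Finset.mem_union.1 he with h | h
    · obtain ⟨j, -, hj⟩ := Finset.mem_biUnion.1 h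
      exact (hval l hl).1 j e hj
    · obtain ⟨j, -, hj⟩ := Finset.mem_biUnion.1 h
      exact (hval l hl).2 j e hj
  have hζ_neg : ∀ e ∈ T, wt ζ e < 0 := by
    intro e he
    rcases Finset.mem_union.1 he with h | h
    · obtain ⟨j, -, hj⟩ := Finset.mem_biUnion.1 h
      exact hζval.1 j e hj
    · obtain ⟨j, -, hj⟩ := Finset.mem_biUnion.1 h
      exact hζval.2 j e hj
  have transfer : ∀ l ∈ S, ∀ p q : Expo, (p = 0 ∨ p ∈ T) → (q = 0 ∨ q ∈ T) →
      wt ζ q ≤ wt ζ p → wt (ξ l) q ≤ wt (ξ l) p := by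
    intro l hl p q hp hq hle
    rcases hp with rfl | hp
    · rcases hq with rfl | hq
      · exact le_rfl
      · rw [hwt0]; exact (hval_neg l hl q hq).le
    · rcases hq with rfl | hq
      · exfalso
        rw [hwt0] at hle
        linarith [hζ_neg p hp]
      · exact (hRξ l hl q hq p hp).1 ((hRζ q hq p hp).2 hle)
  have stransfer : ∀ l ∈ S, ∀ p q : Expo, (p = 0 ∨ p ∈ T) → (q = 0 ∨ q ∈ T) →
      wt ζ q < wt ζ p → wt (ξ l) q < wt (ξ l) p := by
    intro l hl p q hp hq hlt
    rcases hp with rfl | hp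
    · rcases hq with rfl | hq
      · exact absurd hlt (lt_irrefl _)
      · rw [hwt0]; exact hval_neg l hl q hq
    · rcases hq with rfl | hq
      · exfalso
        rw [hwt0] at hlt
        linarith [hζ_neg p hp]
      · by_contra hle
        have h1 : wt ζ p ≤ wt ζ q := (hRζ p hp q hq).1 ((hRξ l hl p hp q hq).2 (not_lt.1 hle))
        exact absurd hlt (not_lt.2 h1)
  have hwt_rep : ∀ (η : Fin 2 → ℝ), ∀ l ∈ S, wt η l = ∑ j, wt η (rep l j) := by
    intro η l hl
    conv_lhs => rw [← hrepsum l hl]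
    exact wt_sum η _ _
  -- cancellation: a letterwise no lighter, somewhere strictly heavier tuple of letters has a cancelled point
  have hcancel0 : ∀ l ∈ S, ∀ a' : Fin m → Expo, (∀ i, a' i = 0 ∨ a' i ∈ T) → (∀ i, wt ζ (rep l i) ≤ wt ζ (a' i)) →
      (∃ i, wt ζ (rep l i) < wt ζ (a' i)) → coeff (∑ j, a' j) (tailDiff u v) = 0 := by
    intro l hl a' hT' hle ⟨i₀, hi₀⟩
    have hgt : wt (ξ l) l < wt (ξ l) (∑ j, a' j) := by
      rw [hwt_rep (ξ l) l hl, wt_sum]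
      refine Finset.sum_lt_sum (fun i _ => transfer l hl (a' i) (rep l i) (hT' i) (hrepT l hl i) (hle i)) ?_
      exact ⟨i₀, Finset.mem_univ _, stransfer l hl (a' i₀) (rep l i₀) (hT' i₀) (hrepT l hl i₀) hi₀⟩
    by_contra h
    have hmem : (∑ j, a' j) ∈ ((tailDiff u v).support : Set Expo) := mem_support_iff.2 h
    have hne : (∑ j, a' j) ≠ l := fun heq => by rw [heq] at hgt; exact lt_irrefl _ hgt
    have := (htopW l hl).2 _ hmem hne
    exact absurd hgt (not_lt.2 this.le)
  -- letterwise non-domination inside `S`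
  have hnodom0 : ∀ l ∈ S, ∀ l' ∈ S, l ≠ l' → ∃ j, wt ζ (rep l j) < wt ζ (rep l' j) := by
    intro l hl l' hl' hne
    by_contra hno
    push Not at hno
    have hge : wt (ξ l') l' ≤ wt (ξ l') l := by
      rw [hwt_rep (ξ l') l hl, hwt_rep (ξ l') l' hl']
      exact Finset.sum_le_sum fun i _ => transfer l' hl' (rep l i) (rep l' i) (hrepT l hl i) (hrepT l' hl' i) (hno i)
    have := (htopW l' hl').2 l (hsupp l hl) hne
    exact absurd hge (not_le.2 this)
  -- upgrades inside the merged family stay in the merged family and are cancelled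
  have hcancelAll : ∀ l ∈ Sa, ∀ l₁ ∈ Sa, ∀ l₂ ∈ Sa, ∀ j j' : Fin m, j ≠ j' →
      wt ζ (rep l j) < wt ζ (rep l₁ j) → wt ζ (rep l j') < wt ζ (rep l₂ j') →
      ∀ a' : Fin m → Expo, (a' = Function.update (rep l) j (rep l₁ j) ∨ a' = Function.update (rep l) j' (rep l₂ j') ∨
          a' = Function.update (Function.update (rep l) j (rep l₁ j)) j' (rep l₂ j')) →
        cF * ∏ i, f i (a' i) = cG * ∏ i, g i (a' i) := by
    intro l hl l₁ hl₁ l₂ hl₂ j j' hjj hj hj' a' ha'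
    have hlS := hSaS l hl; have hl₁S := hSaS l₁ hl₁; have hl₂S := hSaS l₂ hl₂
    -- letters of `a'` are letters of `rep l`, `rep l₁`, `rep l₂` at the same position
    have hletters : ∀ i, a' i = rep l i ∨ a' i = rep l₁ i ∨ a' i = rep l₂ i := by
      intro i
      rcases ha' with rfl | rfl | rfl
      · by_cases hi : i = j
        · subst hi; rw [Function.update_self]; exact Or.inr (Or.inl rfl)
        · rw [Function.update_of_ne hi]; exact Or.inl rfl
      · by_cases hi : i = j'
        · subst hi; rw [Function.update_self]; exact Or.inr (Or.inr rfl)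
        · rw [Function.update_of_ne hi]; exact Or.inl rfl
      · by_cases hi : i = j'
        · subst hi; rw [Function.update_self]; exact Or.inr (Or.inr rfl)
        · rw [Function.update_of_ne hi]
          by_cases hi2 : i = j
          · subst hi2; rw [Function.update_self]; exact Or.inr (Or.inl rfl)
          · rw [Function.update_of_ne hi2]; exact Or.inl rfl
    have hle : ∀ i, wt ζ (rep l i) ≤ wt ζ (a' i) := by
      intro i
      rcases ha' with rfl | rfl | rfl
      · by_cases hi : i = j
        · subst hi; rw [Function.update_self]; exact hj.le
        · rw [Function.update_of_ne hi]
      · by_cases hi : i = j'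
        · subst hi; rw [Function.update_self]; exact hj'.le
        · rw [Function.update_of_ne hi]
      · by_cases hi : i = j'
        · subst hi; rw [Function.update_self]; exact hj'.le
        · rw [Function.update_of_ne hi]
          by_cases hi2 : i = j
          · subst hi2; rw [Function.update_self]; exact hj.le
          · rw [Function.update_of_ne hi2]
    have hlt : ∃ i, wt ζ (rep l i) < wt ζ (a' i) := by
      rcases ha' with rfl | rfl | rfl
      · exact ⟨j, by rw [Function.update_self]; exact hj⟩
      · exact ⟨j', by rw [Function.update_self]; exact hj'⟩
      · exact ⟨j', by rw [Function.update_self]; exact hj'⟩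
    have hT' : ∀ i, a' i = 0 ∨ a' i ∈ T := by
      intro i
      rcases hletters i with h | h | h <;> rw [h]
      · exact hrepT l hlS i
      · exact hrepT l₁ hl₁S i
      · exact hrepT l₂ hl₂S i
    have hPF' : a' ∈ tuples A := by
      have m0 := Fintype.mem_piFinset.1 (hrepPF l hlS)
      have m1 := Fintype.mem_piFinset.1 (hrepPF l₁ hl₁S)
      have m2 := Fintype.mem_piFinset.1 (hrepPF l₂ hl₂S)
      refine Fintype.mem_piFinset.2 fun i => ?_
      rcases hletters i with h | h | h <;> rw [h]
      · exact m0 i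
      · exact m1 i
      · exact m2 i
    have hJ' : ∀ i ∈ J, a' i = a₀ i := by
      intro i hi
      rcases hletters i with h | h | h <;> rw [h]
      · exact hSaJ l hl i hi
      · exact hSaJ l₁ hl₁ i hi
      · exact hSaJ l₂ hl₂ i hi
    have h0 := hcancel0 l hlS a' hT' hle hlt
    rw [hcoef' a' hPF' hJ'] at h0
    exact sub_eq_zero.1 h0
  -- the two classes
  set CF := Sa.filter fun l => cF * ∏ j, f j (rep l j) ≠ 0 ∧
    cF * ∏ j, f j (rep l j) ≠ cG * ∏ j, g j (rep l j) with hCF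
  set CG := Sa.filter fun l => cG * ∏ j, g j (rep l j) ≠ 0 ∧
    cG * ∏ j, g j (rep l j) ≠ cF * ∏ j, f j (rep l j) with hCG
  have hCFcard : CF.card ≤ m + 1 :=
    card_le_of_superset_const cF cG f g ζ rep CF
      (fun l hl l' hl' hne => hnodom0 l (hSaS l (Finset.mem_filter.1 hl).1) l' (hSaS l' (Finset.mem_filter.1 hl').1) hne)
      (fun l hl => (Finset.mem_filter.1 hl).2)
      (fun l hl l₁ hl₁ l₂ hl₂ j j' hjj hj hj' a' ha' =>
        hcancelAll l (Finset.mem_filter.1 hl).1 l₁ (Finset.mem_filter.1 hl₁).1 l₂ (Finset.mem_filter.1 hl₂).1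
          j j' hjj hj hj' a' ha')
  have hCGcard : CG.card ≤ m + 1 :=
    card_le_of_superset_const cG cF g f ζ rep CG
      (fun l hl l' hl' hne => hnodom0 l (hSaS l (Finset.mem_filter.1 hl).1) l' (hSaS l' (Finset.mem_filter.1 hl').1) hne)
      (fun l hl => (Finset.mem_filter.1 hl).2)
      (fun l hl l₁ hl₁ l₂ hl₂ j j' hjj hj hj' a' ha' =>
        (hcancelAll l (Finset.mem_filter.1 hl).1 l₁ (Finset.mem_filter.1 hl₁).1 l₂ (Finset.mem_filter.1 hl₂).1
          j j' hjj hj hj' a' ha').symm)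
  -- cover
  have hcover : Sa ⊆ CF ∪ CG := by
    intro l hl
    have hlS := hSaS l hl
    have hne : coeff l (tailDiff u v) ≠ 0 := mem_support_iff.1 (hsupp l hlS)
    rw [← hrepsum l hlS, hcoef' (rep l) (hrepPF l hlS) (hSaJ l hl)] at hne
    rw [Finset.mem_union]
    by_cases hF0 : cF * ∏ j, f j (rep l j) = 0
    · right
      refine Finset.mem_filter.2 ⟨hl, ?_, fun h => hne (by rw [h, sub_self])⟩
      intro hG0; apply hne; rw [hF0, hG0, sub_self]
    · exact Or.inl (Finset.mem_filter.2 ⟨hl, hF0, fun h => hne (by rw [h, sub_self])⟩)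
  calc Sa.card ≤ (CF ∪ CG).card := Finset.card_le_card hcover
    _ ≤ CF.card + CG.card := Finset.card_union_le _ _
    _ ≤ (m + 1) + (m + 1) := Nat.add_le_add hCFcard hCGcard
    _ = 2 * (m + 1) := by ring

/-! ## Lone families -/

/-- **LONE FAMILY BOUND.**  A sub-family `G ⊆ S` of one cell, with representations in the class `F ≠ G`, all of whose
upgrades at one or two positions by letters of members of `G` are uniquely represented in `∏(A_j ∪ {0})`, has at most
`2(m + 1)` points (`card_clean_class_le` in the classes `F ≠ 0` and, by the `u ↔ v` symmetry, `G ≠ 0`). [folklore] -/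
theorem card_lone_group_le (u v : Fin m → MvPolynomial (Fin 2) ℂ) (A : Fin m → Finset Expo)
    (hA0 : ∀ j, (0 : Expo) ∉ A j) (huA : ∀ j, (u j).support ⊆ A j) (hvA : ∀ j, (v j).support ⊆ A j)
    (R : Expo → Expo → Prop) (S : Finset Expo)
    (hS : ∀ l ∈ S, ∃ ξ : Fin 2 → ℝ, ValidWeight u v ξ ∧ IsStrictTop ξ (logSupport u v) l ∧
      ∀ e ∈ tailSupport u v, ∀ e' ∈ tailSupport u v, (R e e' ↔ wt ξ e ≤ wt ξ e'))
    (ζ : Fin 2 → ℝ) (hζval : ValidWeight u v ζ)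
    (hRζ : ∀ e ∈ tailSupport u v, ∀ e' ∈ tailSupport u v, (R e e' ↔ wt ζ e ≤ wt ζ e'))
    (rep : Expo → Fin m → Expo) (hrepPF : ∀ l ∈ S, rep l ∈ tuples A)
    (hrepsum : ∀ l ∈ S, ∑ j, rep l j = l)
    (G : Finset Expo) (hGS : G ⊆ S)
    (hne : ∀ l ∈ G, ∏ j, hatCoeff (u j) (rep l j) ≠ ∏ j, hatCoeff (v j) (rep l j))
    (huniq : ∀ l ∈ G, ∀ l₁ ∈ G, ∀ l₂ ∈ G, ∀ j j' : Fin m, ∀ a' : Fin m → Expo,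
      (a' = Function.update (rep l) j (rep l₁ j) ∨ a' = Function.update (rep l) j' (rep l₂ j') ∨
          a' = Function.update (Function.update (rep l) j (rep l₁ j)) j' (rep l₂ j')) →
        ∀ b ∈ tuples A, ∑ i, b i = ∑ i, a' i → b = a') :
    G.card ≤ 2 * (m + 1) := by
  classical
  set CF := G.filter fun l => ∏ j, hatCoeff (u j) (rep l j) ≠ 0 ∧
    ∏ j, hatCoeff (u j) (rep l j) ≠ ∏ j, hatCoeff (v j) (rep l j) with hCF
  set CG := G.filter fun l => ∏ j, hatCoeff (v j) (rep l j) ≠ 0 ∧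
    ∏ j, hatCoeff (v j) (rep l j) ≠ ∏ j, hatCoeff (u j) (rep l j) with hCG
  have hCFcard : CF.card ≤ m + 1 := by
    refine card_clean_class_le u v A hA0 huA hvA R S hS ζ hζval hRζ rep hrepPF hrepsum CF
      (fun l hl => hGS (Finset.mem_filter.1 hl).1) (fun l hl => (Finset.mem_filter.1 hl).2) ?_
    intro l hl l₁ hl₁ l₂ hl₂ j j' _ _ _ a' ha' b hb hsum
    exact huniq l (Finset.mem_filter.1 hl).1 l₁ (Finset.mem_filter.1 hl₁).1 l₂ (Finset.mem_filter.1 hl₂).1 j j' a' ha'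
      b hb hsum
  -- the symmetric class
  have hS' : ∀ l ∈ S, ∃ ξ : Fin 2 → ℝ, ValidWeight v u ξ ∧ IsStrictTop ξ (logSupport v u) l ∧
      ∀ e ∈ tailSupport v u, ∀ e' ∈ tailSupport v u, (R e e' ↔ wt ξ e ≤ wt ξ e') := by
    intro l hl
    obtain ⟨ξ, hval, htop, hR⟩ := hS l hl
    refine ⟨ξ, (validWeight_swap u v ξ).2 hval, by rw [logSupport_swap]; exact htop, ?_⟩
    rw [tailSupport_swap]; exact hR
  have hRζ' : ∀ e ∈ tailSupport v u, ∀ e' ∈ tailSupport v u, (R e e' ↔ wt ζ e ≤ wt ζ e') := by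
    rw [tailSupport_swap]; exact hRζ
  have hCGcard : CG.card ≤ m + 1 := by
    refine card_clean_class_le v u A hA0 hvA huA R S hS' ζ ((validWeight_swap u v ζ).2 hζval) hRζ' rep hrepPF hrepsum
      CG (fun l hl => hGS (Finset.mem_filter.1 hl).1) (fun l hl => (Finset.mem_filter.1 hl).2) ?_
    intro l hl l₁ hl₁ l₂ hl₂ j j' _ _ _ a' ha' b hb hsum
    exact huniq l (Finset.mem_filter.1 hl).1 l₁ (Finset.mem_filter.1 hl₁).1 l₂ (Finset.mem_filter.1 hl₂).1 j j' a' ha'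
      b hb hsum
  have hcover : G ⊆ CF ∪ CG := by
    intro l hl
    rw [Finset.mem_union, hCF, hCG, Finset.mem_filter, Finset.mem_filter]
    have h := hne l hl
    by_cases hF0 : ∏ j, hatCoeff (u j) (rep l j) = 0
    · right
      refine ⟨hl, ?_, fun h' => h h'.symm⟩
      intro hG0; exact h (by rw [hF0, hG0])
    · exact Or.inl ⟨hl, hF0, h⟩
  calc G.card ≤ (CF ∪ CG).card := Finset.card_le_card hcover
    _ ≤ CF.card + CG.card := Finset.card_union_le _ _
    _ ≤ (m + 1) + (m + 1) := Nat.add_le_add hCFcard hCGcard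
    _ = 2 * (m + 1) := by ring

end Summit.ValiantsHypothesis.ValiantsHypothesis.Theorems.NewtonUnitEquations.TwoProducts.PlanarCell

end
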